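import Mathlib

/-!
# Stub `stub_lowCollisionDecay` — `MassConcentration → LowCollisionDecay` by Cauchy–Schwarz (crux `PrimeDensityDecay`,
stmt-MatrixMultiplication-14311, line `collision-profile-removal`)

Notation (informal): for a family of pairs `(A i, B i)` of subsets of `ZMod p`, the sharing multiplicity of
a difference `d` is `D(d) = Σ_j #{r ∈ A j ×ˢ B j : r.1 - r.2 = d}`; the mass of a set `R` of differences is
`mass R = Σ_i #{q ∈ A i ×ˢ B i : q.1 - q.2 ∈ R} = Σ_{d ∈ R} D(d)`, and the collision number is
`coincidences = Σ_{i,j} #{(q, r) ∈ (A i ×ˢ B i) × (A j ×ˢ B j) : q.1 - q.2 = r.1 - r.2} = Σ_d D(d)²`.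

The proof: Cauchy–Schwarz `(mass R)² ≤ |R| · Σ_{d∈R} D(d)² ≤ |R| · coincidences`, combined with the
mass-concentration hypothesis (`|R| ≤ η p`, `mass R ≥ n s² − 2 η p s`) at `η = ε / (4 (K + 1))` and the
collision bound `coincidences ≤ K s · n s²`.

The combinatorial identities are adapted from
`Cruxes/PrimeDensityDecay/Lines/kronecker-coupling.lean` (stated directly on the inlined sums, no `def`s).
-/

namespace Summit.MatrixMultiplication.MatrixMultiplication.Theorems.PrimeDensityDecay.LowCollisionDecay

open scoped BigOperators Pointwise

-- adapted from Cruxes/PrimeDensityDecay/Lines/kronecker-coupling.lean (`card_filter_product`)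
/-- Counting a filtered product fibrewise over the first factor. -/
theorem card_filter_product {α β : Type*} (S : Finset α) (T : Finset β) (P : α → β → Prop)
    [∀ a b, Decidable (P a b)] :
    ((S ×ˢ T).filter (fun q => P q.1 q.2)).card = ∑ a ∈ S, (T.filter (fun b => P a b)).card := by
  simp only [Finset.card_filter]
  rw [Finset.sum_product]

-- adapted from Cruxes/PrimeDensityDecay/Lines/kronecker-coupling.lean (`coincidences_eq`)
/-- The collision number equals the sum, over matched pairs `q`, of the sharing multiplicity of `q.1 - q.2`. -/
theorem coincidences_eq {p n : ℕ} (A B : Fin n → Finset (ZMod p)) :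
    (∑ i, ∑ j, (((A i ×ˢ B i) ×ˢ (A j ×ˢ B j)).filter
        fun q : (ZMod p × ZMod p) × (ZMod p × ZMod p) => q.1.1 - q.1.2 = q.2.1 - q.2.2).card) =
      ∑ i, ∑ q ∈ A i ×ˢ B i, ∑ j : Fin n,
        ((A j ×ˢ B j).filter (fun r : ZMod p × ZMod p => r.1 - r.2 = q.1 - q.2)).card := by
  refine Finset.sum_congr rfl fun i _ => ?_
  rw [Finset.sum_comm]
  refine Finset.sum_congr rfl fun j _ => ?_
  rw [card_filter_product (A i ×ˢ B i) (A j ×ˢ B j) (fun q r => q.1 - q.2 = r.1 - r.2)]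
  refine Finset.sum_congr rfl fun q _ => ?_
  congr 1
  ext r
  simp only [Finset.mem_filter, eq_comm]

-- adapted from Cruxes/PrimeDensityDecay/Lines/kronecker-coupling.lean (`card_filter_mem_eq_sum`)
/-- Pairs with difference in `R`, counted fibrewise over the difference. -/
theorem card_filter_mem_eq_sum {p : ℕ} (S : Finset (ZMod p × ZMod p)) (R : Finset (ZMod p)) :
    (S.filter (fun r : ZMod p × ZMod p => r.1 - r.2 ∈ R)).card =
      ∑ d ∈ R, (S.filter (fun r : ZMod p × ZMod p => r.1 - r.2 = d)).card :=
  (Finset.sum_card_fiberwise_eq_card_filter S R (fun r : ZMod p × ZMod p => r.1 - r.2)).symm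

-- adapted from Cruxes/PrimeDensityDecay/Lines/kronecker-coupling.lean (`gridMass_eq_sum_Dmult`)
/-- `mass R = Σ_{d ∈ R} D(d)`. -/
theorem mass_eq_sum {p n : ℕ} (R : Finset (ZMod p)) (A B : Fin n → Finset (ZMod p)) :
    (∑ i, ((A i ×ˢ B i).filter fun q : ZMod p × ZMod p => q.1 - q.2 ∈ R).card) =
      ∑ d ∈ R, ∑ j : Fin n,
        ((A j ×ˢ B j).filter (fun r : ZMod p × ZMod p => r.1 - r.2 = d)).card := by
  rw [Finset.sum_comm]
  exact Finset.sum_congr rfl fun i _ => card_filter_mem_eq_sum (A i ×ˢ B i) R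

-- adapted from Cruxes/PrimeDensityDecay/Lines/kronecker-coupling.lean (`sum_sq_Dmult_le_coincidences`)
/-- `Σ_{d ∈ R} D(d)² ≤ coincidences` (stated for any function `D` agreeing with the sharing multiplicity). -/
theorem sum_sq_le_coincidences {p n : ℕ} (R : Finset (ZMod p)) (A B : Fin n → Finset (ZMod p))
    (D : ZMod p → ℕ)
    (hD : ∀ d, D d =
      ∑ j : Fin n, ((A j ×ˢ B j).filter (fun r : ZMod p × ZMod p => r.1 - r.2 = d)).card) :
    ∑ d ∈ R, D d ^ 2 ≤
      ∑ i, ∑ j, (((A i ×ˢ B i) ×ˢ (A j ×ˢ B j)).filter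
        fun q : (ZMod p × ZMod p) × (ZMod p × ZMod p) => q.1.1 - q.1.2 = q.2.1 - q.2.2).card := by
  have step : ∀ i : Fin n,
      ∑ d ∈ R, ((A i ×ˢ B i).filter (fun r : ZMod p × ZMod p => r.1 - r.2 = d)).card * D d
        ≤ ∑ q ∈ A i ×ˢ B i, D (q.1 - q.2) := by
    intro i
    calc ∑ d ∈ R, ((A i ×ˢ B i).filter (fun r : ZMod p × ZMod p => r.1 - r.2 = d)).card * D d
        = ∑ d ∈ R, ∑ _r ∈ (A i ×ˢ B i).filter (fun r : ZMod p × ZMod p => r.1 - r.2 = d),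
            D d := by
          refine Finset.sum_congr rfl fun d _ => ?_
          rw [Finset.sum_const, smul_eq_mul]
      _ = ∑ q ∈ (A i ×ˢ B i).filter (fun r : ZMod p × ZMod p => r.1 - r.2 ∈ R),
            D (q.1 - q.2) :=
          Finset.sum_fiberwise_eq_sum_filter' _ _ _ _
      _ ≤ ∑ q ∈ A i ×ˢ B i, D (q.1 - q.2) :=
          Finset.sum_le_sum_of_subset (Finset.filter_subset _ _)
  calc ∑ d ∈ R, D d ^ 2
      = ∑ d ∈ R, ∑ i : Fin n,
          ((A i ×ˢ B i).filter (fun r : ZMod p × ZMod p => r.1 - r.2 = d)).card * D d := by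
        refine Finset.sum_congr rfl fun d _ => ?_
        rw [sq, ← Finset.sum_mul, ← hD]
    _ = ∑ i : Fin n, ∑ d ∈ R,
          ((A i ×ˢ B i).filter (fun r : ZMod p × ZMod p => r.1 - r.2 = d)).card * D d :=
        Finset.sum_comm
    _ ≤ ∑ i : Fin n, ∑ q ∈ A i ×ˢ B i, D (q.1 - q.2) :=
        Finset.sum_le_sum fun i _ => step i
    _ = _ := by
        rw [coincidences_eq]
        simp only [hD]

-- adapted from Cruxes/PrimeDensityDecay/Lines/kronecker-coupling.lean (`gridMass_sq_le`)
/-- **Cauchy–Schwarz on the multiplicity profile**: `(mass R)² ≤ |R| · coincidences`. -/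
theorem mass_sq_le {p n : ℕ} (R : Finset (ZMod p)) (A B : Fin n → Finset (ZMod p)) :
    (∑ i, ((A i ×ˢ B i).filter fun q : ZMod p × ZMod p => q.1 - q.2 ∈ R).card) ^ 2 ≤
      R.card * ∑ i, ∑ j, (((A i ×ˢ B i) ×ˢ (A j ×ˢ B j)).filter
        fun q : (ZMod p × ZMod p) × (ZMod p × ZMod p) => q.1.1 - q.1.2 = q.2.1 - q.2.2).card := by
  rw [mass_eq_sum R A B]
  calc (∑ d ∈ R, ∑ j : Fin n,
          ((A j ×ˢ B j).filter (fun r : ZMod p × ZMod p => r.1 - r.2 = d)).card) ^ 2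
      ≤ R.card * ∑ d ∈ R, (∑ j : Fin n,
          ((A j ×ˢ B j).filter (fun r : ZMod p × ZMod p => r.1 - r.2 = d)).card) ^ 2 :=
        sq_sum_le_card_mul_sum_sq
    _ ≤ _ := Nat.mul_le_mul_left _
        (sum_sq_le_coincidences R A B (fun d => ∑ j : Fin n,
          ((A j ×ˢ B j).filter (fun r : ZMod p × ZMod p => r.1 - r.2 = d)).card) fun _ => rfl)

/-- The real-arithmetic core: with `η = ε / (4 (K + 1))`, the bounds `|R| ≤ η P`,
`mass ≥ N S² − 2 η P S` and `mass² ≤ |R| · (K S · N S²)` force `N S ≤ ε P`. -/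
theorem real_core {N S P M Rc K ε : ℝ} (hε : 0 < ε) (hP : 0 < P) (hK : 0 ≤ K) (hN : 0 ≤ N)
    (hS : 0 ≤ S) (hRc : Rc ≤ ε / (4 * (K + 1)) * P)
    (hmass : N * S ^ 2 - 2 * (ε / (4 * (K + 1))) * P * S ≤ M)
    (hcs : M ^ 2 ≤ Rc * (K * S * (N * S ^ 2))) : N * S ≤ ε * P := by
  by_contra hlt
  push Not at hlt
  set η : ℝ := ε / (4 * (K + 1)) with hηdef
  have hK1 : (0 : ℝ) < 4 * (K + 1) := by positivity
  have hη : 0 < η := by positivity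
  have hηK1 : η * (4 * (K + 1)) = ε := div_mul_cancel₀ ε hK1.ne'
  have hNS : 0 < N * S := lt_trans (mul_pos hε hP) hlt
  have hSpos : 0 < S := by
    rcases hS.lt_or_eq with h | h
    · exact h
    · rw [← h, mul_zero] at hNS
      exact absurd hNS (lt_irrefl 0)
  have hNpos : 0 < N := by
    rcases hN.lt_or_eq with h | h
    · exact h
    · rw [← h, zero_mul] at hNS
      exact absurd hNS (lt_irrefl 0)
  have hηε : η ≤ ε / 4 := by nlinarith [hηK1, mul_nonneg hη.le hK]
  have hηK : η * K ≤ ε / 4 := by nlinarith [hηK1, hη.le]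
  have hηP : η * P ≤ N * S / 4 := by nlinarith [mul_le_mul_of_nonneg_right hηε hP.le]
  have h2S : 2 * S * (η * P) ≤ 2 * S * (N * S / 4) :=
    mul_le_mul_of_nonneg_left hηP (by positivity)
  have hM : N * S ^ 2 / 2 ≤ M := by nlinarith [h2S, hmass]
  have hM2 : (N * S ^ 2 / 2) ^ 2 ≤ M ^ 2 := pow_le_pow_left₀ (by positivity) hM 2
  have chain : (N * S ^ 2 / 2) ^ 2 ≤ ε / 4 * (P * (S * (N * S ^ 2))) :=
    calc (N * S ^ 2 / 2) ^ 2 ≤ M ^ 2 := hM2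
      _ ≤ Rc * (K * S * (N * S ^ 2)) := hcs
      _ ≤ (η * P) * (K * S * (N * S ^ 2)) := mul_le_mul_of_nonneg_right hRc (by positivity)
      _ = (η * K) * (P * (S * (N * S ^ 2))) := by ring
      _ ≤ ε / 4 * (P * (S * (N * S ^ 2))) := mul_le_mul_of_nonneg_right hηK (by positivity)
  have key : (N * S) * (N * S ^ 3) ≤ (ε * P) * (N * S ^ 3) := by nlinarith [chain]
  have hNS3 : 0 < N * S ^ 3 := by positivity
  have hle := le_of_mul_le_mul_right key hNS3
  linarith

/-- **Low collision decay from mass concentration**: if the removal export holds (for every `η` a set of `≤ η p`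
private differences carries all but `2 η p s` of the matched mass), then a balanced SDPP family with collision number
`Σ_d D(d)² ≤ K·s·(n s²)` has `n s ≤ ε p` once `s ≥ s₀(K, ε)` (Cauchy–Schwarz on the multiplicity profile). -/
theorem stub_lowCollisionDecay :
    (∀ η : ℝ, 0 < η → ∃ s₀ : ℕ, ∀ p : ℕ, p.Prime → ∀ (n s : ℕ) (A B : Fin n → Finset (ZMod p)),
      s₀ ≤ s → (∀ i : Fin n, (A i).card = s ∧ (B i).card = s) →
      (∀ i : Fin n, ∀ a ∈ A i, ∀ a' ∈ A i, ∀ b ∈ B i, ∀ b' ∈ B i, (a - a') + (b - b') = 0 → a = a' ∧ b = b') →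
      (∀ i j k : Fin n, ∀ a ∈ A i, ∀ a' ∈ A j, ∀ b ∈ B j, ∀ b' ∈ B k, (a - a') + (b - b') = 0 → i = k) →
      ∃ R : Finset (ZMod p), R ⊆ (Finset.univ.biUnion fun i => A i - B i) ∧ (R.card : ℝ) ≤ η * (p : ℝ) ∧
        (n : ℝ) * (s : ℝ) ^ 2 - 2 * η * (p : ℝ) * (s : ℝ) ≤
          ((∑ i, ((A i ×ˢ B i).filter fun q : ZMod p × ZMod p => q.1 - q.2 ∈ R).card : ℕ) : ℝ)) →
    ∀ (K : ℕ) (ε : ℝ), 0 < ε → ∃ s₀ : ℕ, ∀ p : ℕ, p.Prime → ∀ (n s : ℕ) (A B : Fin n → Finset (ZMod p)),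
      s₀ ≤ s → (∀ i : Fin n, (A i).card = s ∧ (B i).card = s) →
      (∀ i : Fin n, ∀ a ∈ A i, ∀ a' ∈ A i, ∀ b ∈ B i, ∀ b' ∈ B i, (a - a') + (b - b') = 0 → a = a' ∧ b = b') →
      (∀ i j k : Fin n, ∀ a ∈ A i, ∀ a' ∈ A j, ∀ b ∈ B j, ∀ b' ∈ B k, (a - a') + (b - b') = 0 → i = k) →
      (∑ i, ∑ j, (((A i ×ˢ B i) ×ˢ (A j ×ˢ B j)).filter
          fun q : (ZMod p × ZMod p) × (ZMod p × ZMod p) => q.1.1 - q.1.2 = q.2.1 - q.2.2).card) ≤ K * s * (n * s ^ 2) →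
      (n : ℝ) * (s : ℝ) ≤ ε * (p : ℝ) := by
  intro hMC K ε hε
  obtain ⟨s₀, hs₀⟩ := hMC (ε / (4 * ((K : ℝ) + 1))) (by positivity)
  refine ⟨s₀, ?_⟩
  intro p hp n s A B hs hcard hW hX hcoll
  obtain ⟨R, -, hRcard, hRmass⟩ := hs₀ p hp n s A B hs hcard hW hX
  have hP : (0 : ℝ) < (p : ℝ) := by exact_mod_cast hp.pos
  have h1 := (mass_sq_le R A B).trans (Nat.mul_le_mul_left R.card hcoll)
  have h2 := (Nat.cast_le (α := ℝ)).mpr h1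
  simp only [Nat.cast_mul, Nat.cast_pow] at h2
  exact real_core hε hP (Nat.cast_nonneg K) (Nat.cast_nonneg n) (Nat.cast_nonneg s) hRcard hRmass h2

end Summit.MatrixMultiplication.MatrixMultiplication.Theorems.PrimeDensityDecay.LowCollisionDecay
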